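import Summits.Langlands.Langlands.Theorems.TwinRigiditySplitPrelude
import Literature.NumberTheory.Automorphic.HilbertModularGaloisRepProofs

/-!
CENSUS LANDING NOTE (decomp-langlands census-1 g29): lens-4 g29 certified landing split `landing/TwinRigiditySplit.lean` with ONE
delta — the local copy of `eventually_natCast_notMem_asIdeal` is deleted and the identical landed declaration
`Literature.NumberTheory.Automorphic.eventually_natCast_notMem_asIdeal` is imported and reused (gate `dedup.landed`); the node's `closes` is
`closes_target` here (registry-owned name rule).  Nothing else changed.

# `TwinRigiditySplit` (kernel; part 2 of 3 — pieces and shadow in `TwinRigiditySplitPrelude`, regular cell in `TwinRigiditySplitRegular`) — lens-4 («minimal counterexample / extremal reduction») g29 node, TYPED-NOT-FILED (route freeze)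

TARGET (BY NAME) = RIGID = `Summit.Langlands.Langlands.Theorems.TatePhantomLift.PerfectLayerRigidity` (verbatim g25
`PerfectLayerClifford.PerfectLayerRigidity`, sha12 `6f5d782b2b84`; crux r3 of the queued slot-4 kit PerfectLayerClifford v3 refining
`GaloisHullLift.PerfectHullDescent` stmt-Langlands-28225; tagged IDEA-NEEDED since g25).  RIGID is the leaf in which BOTH chains of the
lineage bottom out: the g25 direct chain (`closes_host` binder `hR`) and the g26/g28 phantom chain (`SchurObstructionExit.scht_of_pieces`
consumes RIGID one floor up).  RIGID says: along a Galois layer `L/K` with no cyclic sub-layer of prime degree, if the irreducible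
semisimple relative avatar `r : Γ_L → GL_n(ℚ̄_ℓ)` of the L-algebraic cuspidal `π` of `GL_n/K` extends to SOME semisimple `ρ₀` over `K`
(still a relative avatar of `π` on `Γ_L`), then `π` has an `ℓ`-adic avatar over `K`.  By uniqueness of extension across such a layer
(`candidate_unique`, §1) the avatar can only be `ρ₀` itself, so RIGID ⟺ «`ρ₀` is Satake–Frobenius compatible with `π` at the NON-split places».

EXTREMAL READING.  A minimal counterexample to RIGID is one of two objects: (a) a candidate `ρ₀` that is formally automorphic along `L`
(its restriction is the formal base change of `π`) yet corresponds to NO cuspidal representation of `GL_n/K`; or (b) a TWIN PAIR: two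
L-algebraic cuspidal `π ≇ π'` of `GL_n/K` sharing one irreducible relative avatar `r` along `L` (then `ρ₀ := ρ_{π'}` is a candidate for `π` that
is not `π`-compatible).  The split below is exactly this dichotomy:

* **AUT `CandidateAutomorphy` — DECLARED RESIDUAL · WEAKER (RIGID-implied: `aut_of_rigid`) · S-implied (`aut_of_langlands`) · (B)-side ·
  IDEA-NEEDED.**  Every semisimple `ρ₀ : Γ_K → GL_n(ℚ̄_ℓ)` whose restriction to `Γ_L` is irreducible and a relative avatar of `π` is a.e.
  Satake–Frobenius compatible with SOME L-algebraic cuspidal `π'` of `GL_n/K`.  (Automorphy of a Galois representation that is «automorphic after a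
  non-solvable formal base change»; no residual automorphy is available, so no R = T handle; solvable layers are excluded by hypothesis.)
* **ALR `AutomorphicLayerRigidity` — «non-abelian Bauer» · purely AUTOMORPHIC hypotheses/conclusion · S-implied via (A) alone
  (`alr_of_perfect`, `alr_of_langlands`) · NOT RIGID-implied (lateral; `alr_of_ext_rigid` needs EXT) · UNDECIDED in general · n = 1 PROVED
  (`alr_rankOne`) · both-avatars cell PROVED (`alr_pointwise_of_avatars`) · INSTRUMENTABLE.**  Two L-algebraic cuspidal `π, π'` of `GL_n/K` with a
  common irreducible semisimple relative avatar along `L` have the same Satake parameters at almost every place.  Unfolded: `π_v ≅ π'_v` at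
  the places split in `L` (density `1/[L:K]`) and `{α_v^f} = {β_v^f}` at a place whose Frobenius has order `f` — far below every
  multiplicity-one threshold (Ramakrishnan's refined SMO needs agreement outside a set of density `< 1/2n²`; his «mild Tchebotarev theorem
  for GL(n)» is the UPSTAIRS statement for `K/k` cyclic/solvable); the lever is the IRREDUCIBILITY of `r`, a Galois-side condition with no
  automorphic avatar when `BC_{L/K}` does not exist.  NEAR-TWIN (why `r.IsIrreducible` is load-bearing and why split-prime density
  arguments cannot prove ALR): the two 3-dimensional representations `τ, τ^σ` of `A₅` (automorphic on `GL_3/ℚ` as `Ad` of the odd icosahedral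
  weight-one forms) agree at every prime whose Frobenius in `A₅` has order 1, 2 or 3 (density 3/5 ⊇ Spl) and satisfy `{α^5} = {β^5}` at
  order-5 primes, yet `τ ≇ τ^σ`; their common relative avatar along the `A₅`-layer is `1 ⊕ 1 ⊕ 1`, reducible.

KERNEL (0 sorry): `closes_target : CandidateAutomorphy → AutomorphicLayerRigidity → PerfectLayerRigidity` BY NAME — AUT makes the candidate `ρ₀`
the avatar of some `π'`; `r` is then a common relative avatar of `π` and `π'` (Frobenius polynomials on `Γ_L` are unique); ALR forces the
Satake parameters of `π` and `π'` to agree a.e.; so `ρ₀` is `π`-compatible.  EXACTNESS: `aut_of_rigid`, `alr_of_ext_rigid`,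
`rigid_iff_aut_alr (hE : PerfectLayerExtension) : RIGID ↔ AUT ∧ ALR`, `aut_of_langlands`, `alr_of_langlands`.
PROVED CELLS: §1 the Galois shadow of ALR = uniqueness of extension across a layer without cyclic-prime sub-layers (`character_eq_one_of_trivial_on_layer`,
`conj_of_frobenius_on_layer`, `candidate_unique`; g25 node-local lemmas, not in the tree, re-certified here); `alr_pointwise_of_avatars`
(ALR for any pair both of whose members have avatars); `alr_rankOne : AutomorphicLayerRigidityAt 1` (Weil's `ℓ`-adic avatars of algebraic
Hecke characters — `exists_satakeFrobCompatible_rankOne`, a local re-certification of the tree's `ReciprocityUpToIrreducibility.exists_satakeFrobCompatible_rankOne` — + the shadow: a perfect `Gal(L/K)` has no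
characters, so Hecke characters agreeing at `Spl(L/K)` coincide — false for every non-perfect layer, which is why the no-cyclic-prime-layer
hypothesis is sharp already for `n = 1`); §3b `alr_regularAlgebraic_odd (hH : exists_galoisRep_of_regularAlgebraic) (hn : Odd n) :
AutomorphicLayerRigidityRegularAt n` — ALR for REGULAR algebraic `π, π'` of ODD rank over a totally real or CM `K`, from the HLTT/Scholze–Varma named fact BY NAME
(both members then have semisimple avatars: the fact's C-normalised `r` Tate-twisted by `ε_ℓ^{(n-1)/2}`, `exists_avatar_of_regularAlgebraic`, 0 sorry).  HOST COROLLARIES BY NAME: `closes_host : AUT → ALR → FINTYPE → RED° → W1 → SCHT →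
GaloisHullLift.PerfectHullDescent` (through the tree's `SchurObstructionExit.closes_host`), `closes_parent` (ANAB 27861), `closes_grandparent`
(`RootDecomp1.AvatarDescent` 29149).

WHY EACH PIECE IS WEAKER.  AUT ⟸ RIGID (`aut_of_rigid`; converse needs ALR) and AUT's conclusion forgets WHICH `π'`; ALR ⟸ (A) for the two
representations involved (`alr_pointwise_of_avatars`), it never mentions a Galois representation over `K`, and it is decided for `n = 1` where
RIGID's host RPERF is not needed; neither piece alone gives RIGID (probes `HOME/decomp-langlands-lens-4/g29/TwinRigiditySplit.probes.lean`).
WHY NOVEL (relative to the cell).  No node of any lens factors a Galois-hull item through an AUTOMORPHIC–AUTOMORPHIC rigidity statement; the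
nearest tree relative is `DisagreementBeurling.SparseMultiplicityOne` (stmt-Langlands-13938: sparse DISagreement sets), whose regime
(density-one agreement) is disjoint from ALR's (density-`1/|G|` agreement + power data); lens-2's `CliffordTateStructure` twin is (B)-side Lie
structure, lens-1/3/5/6 work on Artin ladders / Iwahori level / rank-one automorphy / weight windows.

PRINT SOURCES (kept here, not in the piece docstrings): uniqueness of extension = Clifford 1937 + Chebotarev + Brauer–Nesbitt (folklore;
Serre, Abelian ℓ-adic representations, I.2.3); `n = 1`: M. Bauer 1916 / Neukirch ANT VII.13.9 (fields are determined by their split primes) and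
Weil 1956 (ℓ-adic avatars of algebraic Hecke characters); multiplicity one: Jacquet–Shalika 1981, D. Ramakrishnan, A mild Tchebotarev theorem
for GL(n), J. Number Theory 146 (2015) 519–533 (arXiv 1003.4498), K. Martin, Strong local-global phenomena for Galois and automorphic
representations (arXiv 1511.00586, Conj. 10 / Thm. 11); the `A₅` near-twin: character table of `A₅` (Fulton–Harris §3.5) with Kim–Shahidi /
Gelbart–Jacquet for the automorphy of `Ad` of weight-one forms.
-/

set_option linter.dupNamespace false
set_option linter.unusedVariables false
set_option linter.style.longLine false

namespace Summit.Langlands.Langlands.Theorems.TwinRigiditySplit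

open scoped BigOperators Topology Matrix Classical
open Filter Set Function
open Literature.NumberTheory.GaloisRepresentations Literature.NumberTheory.Automorphic
open IsDedekindDomain
open Summit.Langlands.Langlands.Theses
open Summit.Langlands.Langlands.Theses.GaloisHullLift
open Summit.Langlands.Langlands.Theorems.TatePhantomLift
open scoped NumberField Polynomial

/-! ## §2 Kernel `closes_target : AUT → ALR → RIGID` BY NAME, and exactness (0 sorry) -/

/-- **closes_target** (the node file's `closes`; registry-owned name rule) — the node's deciding theorem: candidate automorphy and automorphic layer rigidity give
`TatePhantomLift.PerfectLayerRigidity` BY NAME.  (AUT: `ρ₀` is the avatar of some `π'`; `r` is then a common relative avatar of `π` and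
`π'` (`relAvatar_transfer`); ALR: equal Satake parameters a.e.; hence `ρ₀` itself is `π`-compatible.) -/
theorem closes_target (hA : CandidateAutomorphy) (hB : AutomorphicLayerRigidity) : PerfectLayerRigidity := by
  intro K _ _ n hcpt hn π hπ L _ _ _ hGal h1 hnc ℓ _ ι r hr hirr hext hrel
  obtain ⟨ρ₀, hρ₀, h₀⟩ := hext
  haveI := hGal
  have hirr₀ : (ρ₀.restrictField L).IsIrreducible :=
    isIrreducible_restrictField_of_relAvatar π.1 ι r hr hirr hrel ρ₀ hρ₀ h₀
  obtain ⟨π', hπ', hc'⟩ := hA K n hcpt hn π hπ L hGal h1 hnc ℓ ι ρ₀ hρ₀ hirr₀ h₀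
  have h₀' := relAvatar_restrictField_of_compatible (L := L) π'.1 ι ρ₀ hc'
  have hrel' := relAvatar_transfer π.1 π'.1 ι r (ρ₀.restrictField L) h₀ hrel h₀'
  have hαβ := hB K n hcpt hn π hπ π' hπ' L hGal h1 hnc ℓ ι r hr hirr hrel hrel'
  refine ⟨ρ₀, hρ₀, ?_⟩
  filter_upwards [hαβ, hc', AutomorphicRepData.hasSatakeParamAt_cofinite_holds π.1] with v hv hv' hS
  obtain ⟨α, hα⟩ := hS
  obtain ⟨β, hβ, hur, hch⟩ := hv'
  have e : α = β := hv α β hα hβ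
  subst e
  exact ⟨α, hα, hur, hch⟩

/-- **AUT ⟸ RIGID** (exactness, first half): apply RIGID with `r := ρ₀|Γ_L`; the avatar it yields is conjugate to `ρ₀` (`candidate_unique`),
and compatibility is frame-invariant — so `π' := π` does it. -/
theorem aut_of_rigid (hR : PerfectLayerRigidity) : CandidateAutomorphy := by
  intro K _ _ n hcpt hn π hπ L _ _ _ hGal h1 hnc ℓ _ ι ρ₀ hρ₀ hirr₀ h₀
  haveI := hGal
  have hs : (ρ₀.restrictField L).toGaloisRep.IsSemisimple := ρ₀.isSemisimple_restrictField hρ₀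
  obtain ⟨ρ, hρ, hc⟩ := hR K n hcpt hn π hπ L hGal h1 hnc ℓ ι (ρ₀.restrictField L) hs hirr₀ ⟨ρ₀, hρ₀, h₀⟩ h₀
  obtain ⟨P, hP⟩ := candidate_unique hnc π.1 ι (ρ₀.restrictField L) hs hirr₀ h₀ ρ₀ hρ₀ h₀ ρ hρ hc
  refine ⟨π, hπ, ?_⟩
  rw [← hP]
  exact hc.mono fun v hv => (satakeFrobCompatibleAt_conj_iff π.1 ι P ρ v).2 hv

/-- **ALR ⟸ RPERF** (ALR is implied by direction (A) of reciprocity for the two representations involved — here through the host item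
`GaloisHullLift.PerfectHullDescent`, which supplies avatars of `π` and `π'`; then `alr_pointwise_of_avatars`). -/
theorem alr_of_perfect (hP : GaloisHullLift.PerfectHullDescent) : AutomorphicLayerRigidity := by
  intro K _ _ n hcpt hn π hπ π' hπ' L _ _ _ hGal h1 hnc ℓ _ ι r hr hirr hrel hrel'
  haveI := hGal
  obtain ⟨ρ, hρ, hc⟩ := hP K n hcpt hn π hπ L hGal h1 hnc ℓ ι r hr hrel
  obtain ⟨ρ', hρ', hc'⟩ := hP K n hcpt hn π' hπ' L hGal h1 hnc ℓ ι r hr hrel'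
  exact alr_pointwise_of_avatars hnc π.1 π'.1 ι r hr hirr hrel hrel' ρ hρ hc ρ' hρ' hc'

/-- **ALR ⟸ EXT ∧ RIGID** (exactness, second half, modulo the sibling crux EXT: EXT gives candidates for `π` and `π'`, RIGID turns them into
avatars, `alr_pointwise_of_avatars` concludes).  ALR is NOT claimed to follow from RIGID alone. -/
theorem alr_of_ext_rigid (hE : PerfectLayerExtension) (hR : PerfectLayerRigidity) : AutomorphicLayerRigidity := by
  intro K _ _ n hcpt hn π hπ π' hπ' L _ _ _ hGal h1 hnc ℓ _ ι r hr hirr hrel hrel'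
  haveI := hGal
  obtain ⟨ρ, hρ, hc⟩ := hR K n hcpt hn π hπ L hGal h1 hnc ℓ ι r hr hirr (hE K n hcpt hn π hπ L hGal h1 hnc ℓ ι r hr hirr hrel) hrel
  obtain ⟨ρ', hρ', hc'⟩ := hR K n hcpt hn π' hπ' L hGal h1 hnc ℓ ι r hr hirr (hE K n hcpt hn π' hπ' L hGal h1 hnc ℓ ι r hr hirr hrel') hrel'
  exact alr_pointwise_of_avatars hnc π.1 π'.1 ι r hr hirr hrel hrel' ρ hρ hc ρ' hρ' hc'

/-- **RIGID ⟺ AUT ∧ ALR given EXT** (the split is exact on the locus where the sibling crux EXT holds; unconditionally RIGID ⟹ AUT and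
AUT ∧ ALR ⟹ RIGID). -/
theorem rigid_iff_aut_alr (hE : PerfectLayerExtension) : PerfectLayerRigidity ↔ (CandidateAutomorphy ∧ AutomorphicLayerRigidity) :=
  ⟨fun hR => ⟨aut_of_rigid hR, alr_of_ext_rigid hE hR⟩, fun h => closes_target h.1 h.2⟩

/-- AUT is implied by the host item RPERF (via the tree's `rigid_of_perfect`). -/
theorem aut_of_perfect (hP : GaloisHullLift.PerfectHullDescent) : CandidateAutomorphy := aut_of_rigid (rigid_of_perfect hP)
/-- AUT is S-implied. -/
theorem aut_of_langlands (hL : _root_.Langlands) : CandidateAutomorphy := aut_of_perfect (perfect_of_langlands hL)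
/-- ALR is S-implied (through direction (A) only). -/
theorem alr_of_langlands (hL : _root_.Langlands) : AutomorphicLayerRigidity := alr_of_perfect (perfect_of_langlands hL)

/-! ## §3 The first rung of ALR: rank one (PROVED; Weil's `ℓ`-adic avatars of algebraic Hecke characters + the shadow) -/

section RankOne

variable {K : Type} [Field K] [NumberField K] {ℓ : ℕ} [Fact ℓ.Prime]

-- `eventually_natCast_notMem_asIdeal` (places above `ℓ` are finitely many) is REUSED from
-- `Literature.NumberTheory.Automorphic.HilbertModularGaloisRepProofs` (gate dedup.landed, census landing of the twin).

/-- **Direction (A) in rank one, Satake form (Weil 1956)** — local re-certification of the tree's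
`ReciprocityUpToIrreducibility.exists_satakeFrobCompatible_rankOne` (same proof; that Theorems module is not imported here to keep the node's
import closure inside the lineage's): an L-algebraic automorphic character `π` of `GL₁/K` has an `ℓ`-adic avatar `ρ : Γ_K → GL₁(ℚ̄_ℓ)` that is
Satake–Frobenius compatible with `(π, ι)` at almost every place (the Hecke character `χ_π` is algebraic; take Weil's `ℓ`-adic character of `χ_π`,
tree `HeckeCharacter.IsAlgebraic.exists_lAdic`). [Weil 1956; folklore] -/
theorem exists_satakeFrobCompatible_rankOne (hcpt : isCompact_glFiniteIntegralLevel 1 K)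
    (π : CuspidalAutomorphicRepData 1 K hcpt) (hL : π.1.IsLAlgebraic) (ι : PadicAlgCl ℓ ≃+* ℂ) :
    ∃ ρ : FramedGaloisRep K (PadicAlgCl ℓ) 1,
      ∀ᶠ v : HeightOneSpectrum (𝓞 K) in cofinite, SatakeFrobCompatibleAt ι π.1 ρ v := by
  classical
  obtain ⟨χ, hχ⟩ := π.1.exists_heckeCharacter_glOne
  have halg : χ.IsAlgebraic :=
    π.1.isAlgebraic_heckeCharacter_glOne_of_isCAlgebraic hχ (hL.isCAlgebraic_of_odd odd_one)
  obtain ⟨r, hr⟩ := halg.exists_lAdic ι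
  have hunr : ∀ᶠ v : HeightOneSpectrum (𝓞 K) in cofinite, π.1.IsUnramifiedAt v :=
    π.1.hasSatakeParamAt_cofinite_holds
  refine ⟨r, ?_⟩
  filter_upwards [Literature.NumberTheory.Automorphic.eventually_natCast_notMem_asIdeal K ℓ, hunr] with v hvℓ hv
  obtain ⟨α, hα⟩ := hv
  have hur : χ.IsUnramifiedAt v := π.1.isUnramifiedAt_heckeCharacter_glOne hχ hα
  obtain ⟨hunr', hfrob⟩ := hr v hvℓ hur
  refine ⟨α, hα, hunr', ?_⟩
  obtain ⟨ϖ, hϖ, rfl⟩ := π.1.exists_eq_singleton_of_hasSatakeParamAt_glOne hχ hα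
  have hc : ((χ (localUnits v ϖ) : ℂˣ) : ℂ) = χ.valueAtUniformizer v := by
    rw [← HeckeCharacter.localComponent_eq_valueAtUniformizer hur hϖ,
      HeckeCharacter.localComponent_apply]
  rw [arithFrobPolyOfSatake_one, Multiset.map_singleton, Multiset.prod_singleton, hc]
  exact hfrob

end RankOne

/-- **ALR holds for `GL₁` (PROVED RUNG).**  Two L-algebraic automorphic characters of `GL₁/K` with a common relative avatar along a layer without
cyclic-prime sub-layers coincide at almost every place: both have Weil `ℓ`-adic avatars (`exists_satakeFrobCompatible_rankOne`), rank-one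
representations are semisimple, and `alr_pointwise_of_avatars` applies — its engine here is `character_eq_one_of_trivial_on_layer`: the ratio of the
two avatars is a character of `Gal(L/K)`, which is perfect.  (False along every layer WITH a cyclic-prime sub-layer: `(1, ψ)` for a character `ψ`
of `Gal(L/K)` of prime order is a twin pair — the hypothesis is sharp already in rank one.) -/
theorem alr_rankOne : AutomorphicLayerRigidityAt 1 := by
  intro K _ _ hcpt _ π hπ π' hπ' L _ _ _ hGal h1 hnc ℓ _ ι r hr hirr hrel hrel'
  haveI := hGal
  obtain ⟨ρ, hc⟩ := exists_satakeFrobCompatible_rankOne hcpt π hπ ι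
  obtain ⟨ρ', hc'⟩ := exists_satakeFrobCompatible_rankOne hcpt π' hπ' ι
  exact alr_pointwise_of_avatars hnc π.1 π'.1 ι r hr hirr hrel hrel' ρ (FramedRep.isSemisimple_of_rank_one ρ) hc
    ρ' (FramedRep.isSemisimple_of_rank_one ρ') hc'

/-! ## §4 Host corollaries BY NAME (through the tree's `SchurObstructionExit.closes_host` / `closes_parent` / `closes_grandparent`) -/

/-- With the other items of the queued PerfectLayerClifford kit (FINTYPE, RED°) and of its layer-2 child SchurTorsionExit (W1, SCHT):
`GaloisHullLift.PerfectHullDescent` (RPERF, stmt-Langlands-28225) BY NAME. -/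
theorem closes_host (hA : CandidateAutomorphy) (hB : AutomorphicLayerRigidity) (hF : FiniteTypePerfectDescent) (hRed : ReduciblePerfectDescent)
    (hW : LayerDeterminantDescent) (hS : SchurObstructionExit.SchurTorsionLayerExtension) : GaloisHullLift.PerfectHullDescent :=
  SchurObstructionExit.closes_host (closes_target hA hB) hF hRed hW hS

/-- Up one level: `CyclicLayerPeeling.AnabelianLayerDescent` (ANAB, stmt-Langlands-27861). -/
theorem closes_parent (hA : CandidateAutomorphy) (hB : AutomorphicLayerRigidity) (hF : FiniteTypePerfectDescent) (hRed : ReduciblePerfectDescent)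
    (hW : LayerDeterminantDescent) (hS : SchurObstructionExit.SchurTorsionLayerExtension) (hSt : GaloisHullLift.SelfTwistedHullDescent)
    (hTr : GaloisHullLift.TrivialHullDescent) (hC : CyclicLayerPeeling.PrimeCyclicLayerDescent) (hBc : CyclicLayerPeeling.CyclicBaseChangeBelow) :
    CyclicLayerPeeling.AnabelianLayerDescent :=
  SchurObstructionExit.closes_parent (closes_target hA hB) hF hRed hW hS hSt hTr hC hBc

/-- Up two levels: `RootDecomp1.AvatarDescent` (stmt-Langlands-29149). -/
theorem closes_grandparent (hA : CandidateAutomorphy) (hB : AutomorphicLayerRigidity) (hF : FiniteTypePerfectDescent) (hRed : ReduciblePerfectDescent)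
    (hW : LayerDeterminantDescent) (hS : SchurObstructionExit.SchurTorsionLayerExtension) (hSt : GaloisHullLift.SelfTwistedHullDescent)
    (hTr : GaloisHullLift.TrivialHullDescent) (hC : CyclicLayerPeeling.PrimeCyclicLayerDescent) (hBc : CyclicLayerPeeling.CyclicBaseChangeBelow)
    (hS' : CyclicLayerPeeling.SelfTwistedLayerDescent) : RootDecomp1.AvatarDescent :=
  SchurObstructionExit.closes_grandparent (closes_target hA hB) hF hRed hW hS hSt hTr hC hBc hS'

end Summit.Langlands.Langlands.Theorems.TwinRigiditySplit
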